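import Literature.Analysis.TotalPositivity.PolyaFrequencyFunctions
import Mathlib.Analysis.SpecialFunctions.ImproperIntegrals
import Mathlib.MeasureTheory.Measure.Haar.NormedSpace
import Mathlib.MeasureTheory.Group.Integral
import HarnessLib

/-!
# Pólya frequency functions: the one-sided exponential and the elementary closure properties
(Schoenberg 1951, sufficiency half, first steps)

Trunk `Literature/Analysis/TotalPositivity`, proofs file accompanying `PolyaFrequencyFunctions.lean`
(the named fact `schoenberg1951_pf_laplace`).  This file starts the bottom-up formalisation of the
sufficiency half of Schoenberg's theorem ("every `Ψ` of the form (7) is `1/(Laplace transform)` of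
a Pólya frequency function"), following the architecture of the source as restated in
Schoenberg–Whitney 1953, Introduction, pp. 246–247:

1. the one-sided exponential `E(x) = e^{-x}` (`x ≥ 0`), `= 0` (`x < 0`) is a Pólya frequency
   function [SchoenbergWhitney1953, Introduction, example 2, eq. (4)] — proved here
   (`isPolyaFrequencyFun_expIndicator`), the heart being the evaluation of the *staircase
   determinants* `det ‖[y_j ≤ x_i]‖ ∈ {0, 1}` for increasing nodes (`det_stepMatrix_nonneg`);
2. the class of Pólya frequency functions is invariant under `x ↦ Λ(−x)`, `x ↦ Λ(ax)` (`a > 0`),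
   `x ↦ Λ(x + c)`, `Λ ↦ cΛ` (`c > 0`) — proved here; whence the one-sided exponentials of mean `0`
   and variance `δ²`, `Λ_δ(x) = |δ|⁻¹ E(x/δ + 1)` of eq. (5), are Pólya frequency functions
   (`isPolyaFrequencyFun_oneSidedExp`);
3. the Laplace transforms: `∫ e^{−xs} E(x) dx = 1/(1 + s)` (`Re s > −1`), eq. (4)
   (`hasLaplaceTransformInvOn_expIndicator`).

Not here (next files): the basic composition formula and closure under convolution, the normal
frequency function (example 1, eq. (3)), the passage to infinite products, and the necessity half.

## References

* I. J. Schoenberg, *On Pólya frequency functions. I. The totally positive functions and their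
  Laplace transforms*, J. Analyse Math. 1 (1951) 331–374, Lemma 1–2 and §1 (examples).
  [Schoenberg1951]
* I. J. Schoenberg, A. Whitney, *On Pólya frequency functions. III*, Trans. Amer. Math. Soc. 74
  (1953) 246–259, Introduction, (1)–(5). [SchoenbergWhitney1953]
* S. Karlin, *Total Positivity* I, Stanford 1968, Ch. 1 §2 (staircase/`ε`-matrices), Ch. 7 §1.
  [Karlin1968]
-/

noncomputable section

open MeasureTheory Set
open scoped Topology

namespace Literature.Analysis.TotalPositivity

/-! ### Projections of the definition -/

section Closure

variable {Λ : ℝ → ℝ}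

/-- A Pólya frequency function is measurable (field of the definition). [cite: SchoenbergWhitney1953, Introduction (1)] -/
theorem IsPolyaFrequencyFun.measurable (h : IsPolyaFrequencyFun Λ) : Measurable Λ :=
  h.2.1

/-- A Pólya frequency function is integrable (field of the definition). [cite: SchoenbergWhitney1953, Introduction (1)] -/
theorem IsPolyaFrequencyFun.integrable (h : IsPolyaFrequencyFun Λ) : Integrable Λ :=
  h.2.2.1

/-- The translation determinants of a Pólya frequency function with increasing nodes are `≥ 0`
(field of the definition). [cite: SchoenbergWhitney1953, Introduction (2)] -/
theorem IsPolyaFrequencyFun.minor_nonneg (h : IsPolyaFrequencyFun Λ) {n : ℕ} {x y : Fin n → ℝ}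
    (hx : StrictMono x) (hy : StrictMono y) : 0 ≤ translationMinor Λ x y :=
  h.2.2.2.2 n x y hx hy

/-! ### Closure under reflection, dilation, translation and positive multiples -/

/-- Reflecting the argument transposes the translation determinant and swaps the node sets:
`det ‖Λ(−(x_i − y_j))‖ = det ‖Λ(y_i − x_j)‖`. [folklore] -/
theorem translationMinor_comp_neg (Λ : ℝ → ℝ) {n : ℕ} (x y : Fin n → ℝ) :
    translationMinor (fun u => Λ (-u)) x y = translationMinor Λ y x := by
  unfold translationMinor
  rw [← Matrix.det_transpose]
  congr 1
  ext i j
  simp [Matrix.transpose_apply, neg_sub]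

/-- Dilating the argument dilates both node sets. [folklore] -/
theorem translationMinor_comp_mul (Λ : ℝ → ℝ) (a : ℝ) {n : ℕ} (x y : Fin n → ℝ) :
    translationMinor (fun u => Λ (a * u)) x y = translationMinor Λ (a • x) (a • y) := by
  unfold translationMinor
  congr 1
  ext i j
  simp [mul_sub]

/-- Translating the argument translates the second node set. [folklore] -/
theorem translationMinor_comp_add (Λ : ℝ → ℝ) (c : ℝ) {n : ℕ} (x y : Fin n → ℝ) :
    translationMinor (fun u => Λ (u + c)) x y = translationMinor Λ x (fun j => y j - c) := by
  unfold translationMinor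
  congr 1
  ext i j
  simp only [Matrix.of_apply]
  congr 1
  ring

/-- A constant multiple scales an `n × n` translation determinant by `c ^ n`. [folklore] -/
theorem translationMinor_const_mul (Λ : ℝ → ℝ) (c : ℝ) {n : ℕ} (x y : Fin n → ℝ) :
    translationMinor (fun u => c * Λ u) x y = c ^ n * translationMinor Λ x y := by
  unfold translationMinor
  rw [show (Matrix.of fun i j : Fin n => c * Λ (x i - y j)) =
      c • (Matrix.of fun i j : Fin n => Λ (x i - y j)) by ext; simp, Matrix.det_smul,
    Fintype.card_fin]

/-- **Reflection invariance**: with `Λ`, also `x ↦ Λ(−x)` is a Pólya frequency function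
(Schoenberg 1951, remark after Definition 1: the class is invariant under `x ↦ −x`).
[cite: Schoenberg1951, §1] [folklore] -/
theorem IsPolyaFrequencyFun.comp_neg (h : IsPolyaFrequencyFun Λ) :
    IsPolyaFrequencyFun fun u => Λ (-u) := by
  refine ⟨fun x => h.nonneg _, h.measurable.comp measurable_neg, h.integrable.comp_neg, ?_, ?_⟩
  · rw [integral_neg_eq_self (fun u => Λ u)]
    exact h.integral_pos
  · intro n x y hx hy
    rw [translationMinor_comp_neg]
    exact h.minor_nonneg hy hx

/-- **Dilation invariance**: with `Λ`, also `x ↦ Λ(ax)`, `a > 0`, is a Pólya frequency function.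
[cite: Schoenberg1951, §1] [folklore] -/
theorem IsPolyaFrequencyFun.comp_mul (h : IsPolyaFrequencyFun Λ) {a : ℝ} (ha : 0 < a) :
    IsPolyaFrequencyFun fun u => Λ (a * u) := by
  refine ⟨fun x => h.nonneg _, h.measurable.comp (measurable_const_mul a),
    h.integrable.comp_mul_left' ha.ne', ?_, ?_⟩
  · rw [Measure.integral_comp_mul_left (fun u => Λ u)]
    exact smul_pos (abs_pos.2 (inv_ne_zero ha.ne')) h.integral_pos
  · intro n x y hx hy
    rw [translationMinor_comp_mul]
    refine h.minor_nonneg (fun i j hij => ?_) (fun i j hij => ?_)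
    · simpa only [Pi.smul_apply, smul_eq_mul] using mul_lt_mul_of_pos_left (hx hij) ha
    · simpa only [Pi.smul_apply, smul_eq_mul] using mul_lt_mul_of_pos_left (hy hij) ha

/-- **Translation invariance**: with `Λ`, also `x ↦ Λ(x + c)` is a Pólya frequency function.
[cite: Schoenberg1951, §1] [folklore] -/
theorem IsPolyaFrequencyFun.comp_add (h : IsPolyaFrequencyFun Λ) (c : ℝ) :
    IsPolyaFrequencyFun fun u => Λ (u + c) := by
  refine ⟨fun x => h.nonneg _, h.measurable.comp (measurable_add_const c),
    h.integrable.comp_add_right c, ?_, ?_⟩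
  · rw [integral_add_right_eq_self (fun u => Λ u)]
    exact h.integral_pos
  · intro n x y hx hy
    rw [translationMinor_comp_add]
    exact h.minor_nonneg hx fun i j hij => sub_lt_sub_right (hy hij) c

/-- **Affine invariance**: with `Λ`, also `x ↦ Λ(ax + b)`, `a ≠ 0`, is a Pólya frequency function
(combine reflection, dilation and translation). [folklore] -/
theorem IsPolyaFrequencyFun.comp_affine (h : IsPolyaFrequencyFun Λ) {a : ℝ} (ha : a ≠ 0) (b : ℝ) :
    IsPolyaFrequencyFun fun u => Λ (a * u + b) := by
  rcases lt_or_gt_of_ne ha with ha' | ha'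
  · have h1 := ((h.comp_add b).comp_neg).comp_mul (neg_pos.2 ha')
    convert h1 using 1
    funext u
    simp only [neg_mul, neg_neg]
  · exact (h.comp_add b).comp_mul ha'

/-- **Positive multiples**: with `Λ`, also `cΛ`, `c > 0`, is a Pólya frequency function.
[folklore] -/
theorem IsPolyaFrequencyFun.const_mul (h : IsPolyaFrequencyFun Λ) {c : ℝ} (hc : 0 < c) :
    IsPolyaFrequencyFun fun u => c * Λ u := by
  refine ⟨fun x => mul_nonneg hc.le (h.nonneg _), h.measurable.const_mul c,
    h.integrable.const_mul c, ?_, ?_⟩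
  · rw [integral_const_mul]
    exact mul_pos hc h.integral_pos
  · intro n x y hx hy
    rw [translationMinor_const_mul]
    exact mul_nonneg (pow_nonneg hc.le _) (h.minor_nonneg hx hy)

end Closure

/-! ### The staircase determinant and the one-sided exponential -/

/-- **Staircase determinants are `≥ 0`.**  For strictly increasing `x, y : Fin n → ℝ` the `0/1`
matrix `B_{ij} = [y_j ≤ x_i]` (rows are initial segments of ones, weakly growing with `i`) has
`det B ≥ 0` (in fact `∈ {0, 1}`).  Induction on `n` along the first row: if `y₀ > x₀` the first
row vanishes; if `y₁ ≤ x₀` the first two columns coincide; otherwise the first row is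
`(1, 0, …, 0)` and Laplace expansion reduces to the same determinant for `x ∘ succ`, `y ∘ succ`.
[cite: Karlin1968, Ch. 1 §2] [folklore] -/
theorem det_stepMatrix_nonneg : ∀ (n : ℕ) (x y : Fin n → ℝ), StrictMono x → StrictMono y →
    0 ≤ (Matrix.of fun i j : Fin n => if y j ≤ x i then (1 : ℝ) else 0).det := by
  intro n
  induction n with
  | zero => intro x y _ _; simp
  | succ n ih =>
    intro x y hx hy
    by_cases h0 : y 0 ≤ x 0
    · by_cases h1 : ∃ j : Fin (n + 1), j ≠ 0 ∧ y j ≤ x 0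
      · -- two equal columns
        obtain ⟨j, hj0, hj⟩ := h1
        refine (Matrix.det_zero_of_column_eq hj0.symm fun k => ?_).symm.le
        have hk0 : y 0 ≤ x k := h0.trans (hx.monotone (Fin.zero_le k))
        have hkj : y j ≤ x k := hj.trans (hx.monotone (Fin.zero_le k))
        simp [hk0, hkj]
      · -- first row `(1, 0, …, 0)`: expand
        push Not at h1
        rw [Matrix.det_succ_row_zero, Finset.sum_eq_single (0 : Fin (n + 1))]
        · simp only [Fin.val_zero, pow_zero, one_mul, Matrix.of_apply, if_pos h0,
            Fin.succAbove_zero]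
          have hsub : (Matrix.of fun i j : Fin (n + 1) => if y j ≤ x i then (1 : ℝ) else 0).submatrix
              Fin.succ Fin.succ =
              Matrix.of fun i j : Fin n =>
                if (y ∘ Fin.succ) j ≤ (x ∘ Fin.succ) i then (1 : ℝ) else 0 := by
            ext i j
            simp
          rw [hsub]
          exact ih _ _ (hx.comp (Fin.strictMono_succ)) (hy.comp (Fin.strictMono_succ))
        · intro j _ hj
          simp [h1 j hj]
        · intro h
          exact absurd (Finset.mem_univ _) h
    · -- first row zero
      refine (Matrix.det_eq_zero_of_row_eq_zero 0 fun j => ?_).symm.le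
      have : x 0 < y j := (not_le.1 h0).trans_le (hy.monotone (Fin.zero_le j))
      simp [not_le.2 this]

/-- **The one-sided exponential is a Pólya frequency function** (Schoenberg's example 2):
`E(x) = e^{−x}` for `x ≥ 0`, `E(x) = 0` for `x < 0`.  Its translation determinant factors as
`det ‖E(x_i − y_j)‖ = (∏ e^{−x_i}) (∏ e^{y_j}) · det ‖[y_j ≤ x_i]‖ ≥ 0`.
[cite: SchoenbergWhitney1953, Introduction, example 2, eq. (4)]
[cite: Schoenberg1951, §1 (examples)] -/
theorem isPolyaFrequencyFun_expIndicator :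
    IsPolyaFrequencyFun ((Set.Ici (0 : ℝ)).indicator fun u => Real.exp (-u)) := by
  refine ⟨?_, ?_, ?_, ?_, ?_⟩
  · exact fun u => Set.indicator_nonneg (fun v _ => (Real.exp_pos _).le) u
  · exact (Real.continuous_exp.comp continuous_neg).measurable.indicator measurableSet_Ici
  · rw [integrable_indicator_iff measurableSet_Ici, integrableOn_Ici_iff_integrableOn_Ioi]
    exact integrableOn_exp_neg_Ioi 0
  · rw [integral_indicator measurableSet_Ici, integral_Ici_eq_integral_Ioi,
      integral_exp_neg_Ioi_zero]
    exact one_pos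
  · intro n x y hx hy
    unfold translationMinor
    have hM : (Matrix.of fun i j : Fin n =>
        (Set.Ici (0 : ℝ)).indicator (fun u => Real.exp (-u)) (x i - y j)) =
        Matrix.of fun i j : Fin n => Real.exp (-x i) *
          (Matrix.of fun i j : Fin n => Real.exp (y j) *
            (Matrix.of fun i j : Fin n => if y j ≤ x i then (1 : ℝ) else 0) i j) i j := by
      ext i j
      simp only [Matrix.of_apply, Set.indicator_apply, Set.mem_Ici, sub_nonneg]
      split_ifs with h
      · rw [mul_one, ← Real.exp_add]
        congr 1
        ring
      · simp
    rw [hM, Matrix.det_mul_column, Matrix.det_mul_row]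
    exact mul_nonneg (Finset.prod_nonneg fun i _ => (Real.exp_pos _).le)
      (mul_nonneg (Finset.prod_nonneg fun i _ => (Real.exp_pos _).le)
        (det_stepMatrix_nonneg n x y hx hy))

/-- **The one-sided exponentials of mean `0` and variance `δ²`** (Schoenberg–Whitney (5)),
`Λ_δ(x) = |δ|⁻¹ E(x/δ + 1)` (`δ ≠ 0`; descending for `δ > 0`, ascending for `δ < 0`), are Pólya
frequency functions. [cite: SchoenbergWhitney1953, Introduction, eq. (5)] -/
theorem isPolyaFrequencyFun_oneSidedExp {δ : ℝ} (hδ : δ ≠ 0) :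
    IsPolyaFrequencyFun fun u =>
      |δ|⁻¹ * (Set.Ici (0 : ℝ)).indicator (fun u => Real.exp (-u)) (u / δ + 1) := by
  have h := (isPolyaFrequencyFun_expIndicator.comp_affine (inv_ne_zero hδ) 1).const_mul
    (inv_pos.2 (abs_pos.2 hδ))
  convert h using 3
  simp [div_eq_inv_mul]

/-! ### Laplace transforms -/

/-- The Laplace integrand of the one-sided exponential is the indicator of `[0, ∞)` times
`e^{−(1+s)x}`. [folklore] -/
theorem laplaceIntegrand_expIndicator (s : ℂ) :
    (fun x : ℝ => Complex.exp (-(x : ℂ) * s) *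
        (((Set.Ici (0 : ℝ)).indicator (fun u => Real.exp (-u)) x : ℝ) : ℂ)) =
      (Set.Ici (0 : ℝ)).indicator fun x : ℝ => Complex.exp (-(1 + s) * (x : ℂ)) := by
  funext x
  by_cases hx : x ∈ Set.Ici (0 : ℝ)
  · rw [Set.indicator_of_mem hx, Set.indicator_of_mem hx, Complex.ofReal_exp, ← Complex.exp_add]
    congr 1
    push_cast
    ring
  · rw [Set.indicator_of_notMem hx, Set.indicator_of_notMem hx]
    simp

/-- **Laplace transform of the one-sided exponential** (Schoenberg–Whitney (4)):
`∫ e^{−xs} E(x) dx = 1/(1 + s)` for `Re s > −1`, the integral converging absolutely; stated in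
the tree's vocabulary `HasLaplaceTransformInvOn E (1 + ·) (−1) b` for every `b`.
[cite: SchoenbergWhitney1953, Introduction, eq. (4)] -/
theorem hasLaplaceTransformInvOn_expIndicator (b : ℝ) :
    HasLaplaceTransformInvOn ((Set.Ici (0 : ℝ)).indicator fun u => Real.exp (-u))
      (fun s => 1 + s) (-1) b := by
  intro s hs _
  have hre : (-(1 + s)).re < 0 := by
    simp only [Complex.neg_re, Complex.add_re, Complex.one_re, neg_lt_zero]
    linarith
  have hne : (1 + s) ≠ 0 := by
    intro h0
    have := congrArg Complex.re h0
    simp only [Complex.add_re, Complex.one_re, Complex.zero_re] at this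
    linarith
  refine ⟨?_, hne, ?_⟩
  · rw [laplaceIntegrand_expIndicator, integrable_indicator_iff measurableSet_Ici,
      integrableOn_Ici_iff_integrableOn_Ioi]
    exact integrableOn_exp_mul_complex_Ioi hre 0
  · rw [laplaceIntegrand_expIndicator, integral_indicator measurableSet_Ici,
      integral_Ici_eq_integral_Ioi, integral_exp_mul_complex_Ioi hre 0]
    simp only [Complex.ofReal_zero, mul_zero, Complex.exp_zero]
    field_simp

/-! ### Behaviour of the Laplace transform under the affine group -/

section LaplaceClosure

variable {Λ Λ' : ℝ → ℝ} {Ψ Ψ' : ℂ → ℂ} {a b : ℝ}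

/-- Shrinking the strip. [folklore] -/
theorem HasLaplaceTransformInvOn.mono (h : HasLaplaceTransformInvOn Λ Ψ a b) {a' b' : ℝ}
    (ha : a ≤ a') (hb : b' ≤ b) : HasLaplaceTransformInvOn Λ Ψ a' b' :=
  fun s hs1 hs2 => h s (lt_of_le_of_lt ha hs1) (lt_of_lt_of_le hs2 hb)

/-- Transfer along equal functions and along `Ψ = Ψ'` on the strip. [folklore] -/
theorem HasLaplaceTransformInvOn.congr (h : HasLaplaceTransformInvOn Λ Ψ a b) (hΛ : Λ = Λ')
    (hΨ : ∀ s : ℂ, a < s.re → s.re < b → Ψ s = Ψ' s) : HasLaplaceTransformInvOn Λ' Ψ' a b := by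
  intro s hs1 hs2
  obtain ⟨hi, hne, heq⟩ := h s hs1 hs2
  subst hΛ
  rw [hΨ s hs1 hs2] at hne heq
  exact ⟨hi, hne, heq⟩

/-- **Reflection**: `x ↦ Λ(−x)` has reciprocal transform `Ψ(−s)` on the reflected strip.
[folklore] -/
theorem HasLaplaceTransformInvOn.comp_neg (h : HasLaplaceTransformInvOn Λ Ψ a b) :
    HasLaplaceTransformInvOn (fun u => Λ (-u)) (fun s => Ψ (-s)) (-b) (-a) := by
  intro s hs1 hs2
  have hs : a < (-s).re ∧ (-s).re < b := by
    simp only [Complex.neg_re]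
    constructor <;> linarith
  obtain ⟨hi, hne, heq⟩ := h (-s) hs.1 hs.2
  have hfun : (fun x : ℝ => Complex.exp (-(x : ℂ) * s) * (Λ (-x) : ℂ)) =
      fun x : ℝ => (fun y : ℝ => Complex.exp (-(y : ℂ) * (-s)) * (Λ y : ℂ)) (-x) := by
    funext x
    simp only [Complex.ofReal_neg, neg_neg, mul_neg, neg_mul]
  refine ⟨?_, hne, ?_⟩
  · rw [hfun]
    exact hi.comp_neg
  · rw [hfun, integral_neg_eq_self (fun y : ℝ => Complex.exp (-(y : ℂ) * (-s)) * (Λ y : ℂ))]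
    exact heq

/-- **Translation**: `x ↦ Λ(x + c)` has transform `e^{cs} · (1/Ψ(s))`, i.e. reciprocal transform
`e^{−cs} Ψ(s)`, on the same strip. [folklore] -/
theorem HasLaplaceTransformInvOn.comp_add (h : HasLaplaceTransformInvOn Λ Ψ a b) (c : ℝ) :
    HasLaplaceTransformInvOn (fun u => Λ (u + c)) (fun s => Complex.exp (-(c : ℂ) * s) * Ψ s)
      a b := by
  intro s hs1 hs2
  obtain ⟨hi, hne, heq⟩ := h s hs1 hs2
  have hfun : (fun x : ℝ => Complex.exp (-(x : ℂ) * s) * (Λ (x + c) : ℂ)) =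
      fun x : ℝ => Complex.exp ((c : ℂ) * s) *
        ((fun y : ℝ => Complex.exp (-(y : ℂ) * s) * (Λ y : ℂ)) (x + c)) := by
    funext x
    simp only [Complex.ofReal_add]
    rw [← mul_assoc, ← Complex.exp_add]
    congr 2
    ring
  refine ⟨?_, mul_ne_zero (Complex.exp_ne_zero _) hne, ?_⟩
  · rw [hfun]
    exact (hi.comp_add_right c).const_mul _
  · rw [hfun, integral_const_mul,
      integral_add_right_eq_self (fun y : ℝ => Complex.exp (-(y : ℂ) * s) * (Λ y : ℂ)) c, heq]
    beta_reduce
    rw [neg_mul, Complex.exp_neg]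
    field_simp [Complex.exp_ne_zero]

/-- **Dilation** by `r > 0`: `x ↦ Λ(rx)` has transform `r⁻¹ · (1/Ψ(s/r))`, i.e. reciprocal
transform `r Ψ(s/r)`, on the dilated strip. [folklore] -/
theorem HasLaplaceTransformInvOn.comp_mul (h : HasLaplaceTransformInvOn Λ Ψ a b) {r : ℝ}
    (hr : 0 < r) :
    HasLaplaceTransformInvOn (fun u => Λ (r * u)) (fun s => (r : ℂ) * Ψ (s / r)) (r * a)
      (r * b) := by
  intro s hs1 hs2
  have hs : a < (s / r).re ∧ (s / r).re < b := by
    rw [Complex.div_ofReal_re]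
    constructor
    · rw [lt_div_iff₀ hr]
      linarith
    · rw [div_lt_iff₀ hr]
      linarith
  obtain ⟨hi, hne, heq⟩ := h (s / r) hs.1 hs.2
  have hr' : (r : ℂ) ≠ 0 := Complex.ofReal_ne_zero.2 hr.ne'
  have hfun : (fun x : ℝ => Complex.exp (-(x : ℂ) * s) * (Λ (r * x) : ℂ)) =
      fun x : ℝ => (fun y : ℝ => Complex.exp (-(y : ℂ) * (s / r)) * (Λ y : ℂ)) (r * x) := by
    funext x
    simp only [Complex.ofReal_mul]
    congr 2
    field_simp
  refine ⟨?_, mul_ne_zero hr' hne, ?_⟩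
  · rw [hfun]
    exact hi.comp_mul_left' hr.ne'
  · rw [hfun, Measure.integral_comp_mul_left
      (fun y : ℝ => Complex.exp (-(y : ℂ) * (s / r)) * (Λ y : ℂ)) r, heq,
      abs_of_pos (inv_pos.2 hr), Complex.real_smul]
    push_cast
    field_simp

/-- **Positive multiples**: `cΛ` has reciprocal transform `c⁻¹ Ψ`. [folklore] -/
theorem HasLaplaceTransformInvOn.const_mul (h : HasLaplaceTransformInvOn Λ Ψ a b) {c : ℝ}
    (hc : c ≠ 0) :
    HasLaplaceTransformInvOn (fun u => c * Λ u) (fun s => (c : ℂ)⁻¹ * Ψ s) a b := by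
  intro s hs1 hs2
  obtain ⟨hi, hne, heq⟩ := h s hs1 hs2
  have hc' : (c : ℂ) ≠ 0 := Complex.ofReal_ne_zero.2 hc
  have hfun : (fun x : ℝ => Complex.exp (-(x : ℂ) * s) * ((c * Λ x : ℝ) : ℂ)) =
      fun x : ℝ => (c : ℂ) * (Complex.exp (-(x : ℂ) * s) * (Λ x : ℂ)) := by
    funext x
    push_cast
    ring
  refine ⟨?_, mul_ne_zero (inv_ne_zero hc') hne, ?_⟩
  · rw [hfun]
    exact hi.const_mul _
  · rw [hfun, integral_const_mul, heq]
    field_simp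

end LaplaceClosure

/-- **Laplace transform of the one-sided exponential of variance `δ²`** (Schoenberg–Whitney (5)):
`∫ e^{−xs} Λ_δ(x) dx = e^{δs}/(1 + δs)`, i.e. reciprocal transform `(1 + δs) e^{−δs}` — exactly
the factor of the product (7) — absolutely convergent for `Re(1 + δs) > 0`; stated on every strip
`−ρ < Re s < ρ` with `ρ ≤ |δ|⁻¹`. [cite: SchoenbergWhitney1953, Introduction, eq. (5)] -/
theorem hasLaplaceTransformInvOn_oneSidedExp {δ : ℝ} (hδ : δ ≠ 0) {ρ : ℝ} (hρ : ρ ≤ |δ|⁻¹) :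
    HasLaplaceTransformInvOn
      (fun u => |δ|⁻¹ * (Set.Ici (0 : ℝ)).indicator (fun u => Real.exp (-u)) (u / δ + 1))
      (fun s => (1 + (δ : ℂ) * s) * Complex.exp (-((δ : ℂ) * s))) (-ρ) ρ := by
  set E : ℝ → ℝ := (Set.Ici (0 : ℝ)).indicator fun u => Real.exp (-u) with hE
  have hδC : (δ : ℂ) ≠ 0 := Complex.ofReal_ne_zero.2 hδ
  rcases lt_or_gt_of_ne hδ with hneg | hpos
  · -- ascending exponential, `δ < 0`
    have habs : |δ| = -δ := abs_of_neg hneg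
    have hr : 0 < -δ⁻¹ := by
      rw [neg_pos]
      exact inv_lt_zero.2 hneg
    have h1 := (((hasLaplaceTransformInvOn_expIndicator (ρ * (-δ))).comp_add 1).comp_neg).comp_mul
      hr
    have h2 := h1.const_mul (inv_ne_zero (abs_ne_zero.2 hδ))
    refine (h2.mono ?_ ?_).congr ?_ ?_
    · have : -δ⁻¹ * -(ρ * -δ) = -ρ := by field_simp
      rw [this]
    · rw [habs] at hρ
      have : -δ⁻¹ * -(-1 : ℝ) = (-δ)⁻¹ := by field_simp
      rw [this]
      exact hρ
    · funext u
      simp only [hE]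
      congr 2
      field_simp
    · intro s _ _
      rw [habs]
      simp only [Complex.ofReal_neg, Complex.ofReal_inv, Complex.ofReal_one, div_neg,
        div_inv_eq_mul, neg_neg, mul_neg, neg_mul, one_mul, inv_inv]
      field_simp
  · -- descending exponential, `δ > 0`
    have habs : |δ| = δ := abs_of_pos hpos
    have hr : 0 < δ⁻¹ := inv_pos.2 hpos
    have h1 := ((hasLaplaceTransformInvOn_expIndicator (ρ * δ)).comp_add 1).comp_mul hr
    have h2 := h1.const_mul (inv_ne_zero (abs_ne_zero.2 hδ))
    refine (h2.mono ?_ ?_).congr ?_ ?_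
    · rw [habs] at hρ
      have : δ⁻¹ * (-1 : ℝ) = -δ⁻¹ := by ring
      rw [this]
      exact neg_le_neg hρ
    · have : δ⁻¹ * (ρ * δ) = ρ := by field_simp
      rw [this]
    · funext u
      simp only [hE]
      congr 2
      field_simp
    · intro s _ _
      rw [habs]
      simp only [Complex.ofReal_inv, Complex.ofReal_one, div_inv_eq_mul, neg_mul, one_mul,
        inv_inv]
      field_simp

end Literature.Analysis.TotalPositivity

end
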